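import Summits.BirchSwinnertonDyer.Rank1Residual.ManinAdditive.SigmaTheta
import Summits.BirchSwinnertonDyer.Rank1Residual.ManinAdditive.SigmaThetaParityNode
import Summits.BirchSwinnertonDyer.Rank1Residual.ManinAdditive.SigmaThetaFamily
import Summits.BirchSwinnertonDyer.Rank1Residual.ManinAdditive.SigmaThetaRadical
import HarnessLib

/-!
# The `SigmaTheta` nodes hold (an g35, T-an-37, Part B — by-name closures)

By-name closures over `SigmaTheta.lean` (p708123):
* node S-an-g34-2 `KroneckerShimuraCharAtFour` is `SigmaThetaParity.exists_shimuraTwoChar_eq_jacobiSym` (statement verbatim),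
  hence S-an-g34-1 `ShimuraTwoCharOfJacobiProductAtFour` and **E-an-155** `EtaSquareKummerIsSigmaAtFour` (`V_sq ⊆ Σ(N)[2]` for
  every `4 ∣ N`) hold outright;
* **E-an-156** `ShimuraTwoCharIffFactorsThrough` is `SigmaThetaRadical.isShimuraTwoChar_iff_factorsThrough` (`shimuraRadical N`
  unfolds to the product there);
* **E-an-157** `ThetaFamilyIntegral` is `SigmaThetaParity.thetaFamily_integral` at `r = 2·thetaVec m` (`thetaVec = thetaBody` by `rfl`).
All five are definitional transports; nothing asserted.

TYPER NOTE (typer g19, TURNKEY T-an-37 v2, file B).  SOURCE = HOME/an/g35/SigmaThetaHolds-an-g35.lean sha16 d2f5e20a011f348b VERBATIM except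
this note and the imports: an's single module `SigmaThetaParity` was split for the 400-line cap into `SigmaThetaParity` (lemmas) →
`SigmaThetaParityNode` (`exists_shimuraTwoChar_eq_jacobiSym`) and `SigmaThetaFamily` (`thetaFamily_integral`), so this file imports
`SigmaTheta` + `SigmaThetaParityNode` + `SigmaThetaFamily` + `SigmaThetaRadical`.  After this file lands, `SigmaTheta.lean` has NO open
`@[conjecture]` left except E-an-154 `SigmaTwoIsEtaKummerAtFour` (the constructive half `Σ(N)[2] ⊆ V_sq`).  Theorem-only.
PARTITION 0 · beyond-print theorem: yes, modest (an) · BSD / C2 / Manin `c = 1` NOT proved by this.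
-/

namespace Summit.BirchSwinnertonDyer.Rank1Residual.ManinAdditive.SigmaEta

/-- **Node S-an-g34-2 closed.** -/
theorem kroneckerShimuraCharAtFour_holds : KroneckerShimuraCharAtFour :=
  exists_shimuraTwoChar_eq_jacobiSym

/-- **S-an-g34-1** (the Jacobi-product node of `SigmaEtaKummer.lean`) holds. -/
theorem shimuraTwoCharOfJacobiProductAtFour_holds : ShimuraTwoCharOfJacobiProductAtFour :=
  shimuraTwoCharOfJacobiProductAtFour_of_kronecker kroneckerShimuraCharAtFour_holds

/-- **E-an-155 unconditional**: `EtaSquareKummerIsSigmaAtFour`. -/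
theorem etaSquareKummerIsSigmaAtFour_holds : EtaSquareKummerIsSigmaAtFour :=
  etaSquareKummerIsSigmaAtFour_of_kronecker kroneckerShimuraCharAtFour_holds

/-- **E-an-156 unconditional**: `ShimuraTwoCharIffFactorsThrough`. -/
theorem shimuraTwoCharIffFactorsThrough_holds : ShimuraTwoCharIffFactorsThrough :=
  fun N h4N χ => isShimuraTwoChar_iff_factorsThrough N h4N χ

/-- **E-an-157 unconditional**: `ThetaFamilyIntegral`. -/
theorem thetaFamilyIntegral_holds : ThetaFamilyIntegral :=
  fun m hm => thetaFamily_integral m hm (fun t => 2 * thetaVec m t) (fun _ => rfl)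

end Summit.BirchSwinnertonDyer.Rank1Residual.ManinAdditive.SigmaEta
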